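import Mathlib
import Summits.Ventures.DiscreteObjects.Mahler.LehmerExactMeasure

/-!
# Lehmer's number is a Salem number of degree 10 (venture `DiscreteObjects`, target L)

Cell `pub-namedobj`, seat `pub-namedobj-mahler` (gen 9). Framing: lottery ticket; floor = certified
bounds/negative ranges.

The root structure of Lehmer's polynomial `L = x¹⁰+x⁹-x⁷-x⁶-x⁵-x⁴-x³+x+1`, extracted from the method of
`LehmerExactMeasure` (g2): over `ℂ`, `L = ∏ᵢ (x² - yᵢ x + 1)` over the five real roots
`y₁ < y₂ < y₃ < y₄ < 2 < y₅` of the trace polynomial `Q(y) = y⁵+y⁴-5y³-5y²+4y+3`; the four factors with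
`|yᵢ| < 2` have their roots on the unit circle, the last one has the real roots `τ = (y₅ + √(y₅²-4))/2 > 1`
and `τ⁻¹`.  Hence every complex root of `L` is `τ`, `τ⁻¹`, or of modulus `1`, and `M(L) = τ`
(`lehmer_salem`).  Together with `irreducible_lehmerPoly` (p268683) and `deg L = 10`: **Lehmer's number
`τ = M(L) = 1.17628…` is a Salem number of degree `10` with minimal polynomial `L`.**

* `norm_eq_one_of_quad_root`, `eq_or_eq_inv_of_quad_root` — roots of `x² - yx + 1` for real `y`;
* `lehmerPoly_map_eq_prod` — the factorisation over `ℂ` with the root brackets;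
* `lehmer_salem` — **the Salem structure of the roots of `L`**.
-/

namespace Summit.Ventures.DiscreteObjects.Mahler

open Polynomial
open scoped ComplexConjugate

/-- For real `-2 < y < 2`, every root of `x² - yx + 1` has modulus `1`. -/
theorem norm_eq_one_of_quad_root {y : ℝ} (h1 : -2 < y) (h2 : y < 2) {α : ℂ}
    (h : α ^ 2 - (y : ℂ) * α + 1 = 0) : ‖α‖ = 1 := by
  have hpos : 0 ≤ 4 - y ^ 2 := by nlinarith
  set s : ℝ := Real.sqrt (4 - y ^ 2) with hs
  have hs2 : s ^ 2 = 4 - y ^ 2 := by rw [hs]; exact Real.sq_sqrt hpos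
  set z₁ : ℂ := ((y : ℂ) + (s : ℂ) * Complex.I) / 2 with hz₁
  set z₂ : ℂ := ((y : ℂ) - (s : ℂ) * Complex.I) / 2 with hz₂
  have hs2c : (s : ℂ) ^ 2 = 4 - (y : ℂ) ^ 2 := by exact_mod_cast hs2
  have hsum : z₁ + z₂ = (y : ℂ) := by rw [hz₁, hz₂]; ring
  have hprod : z₁ * z₂ = 1 := by
    rw [hz₁, hz₂]
    have hI : Complex.I ^ 2 = -1 := Complex.I_sq
    linear_combination (1 / 4 : ℂ) * hs2c - ((s : ℂ) ^ 2 / 4) * hI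
  have hconj : conj z₁ = z₂ := by
    rw [hz₁, hz₂]
    simp [map_div₀, Complex.conj_ofReal, map_ofNat, sub_eq_add_neg]
  have hn1 : ‖z₁‖ = 1 := by
    have hm := Complex.mul_conj z₁
    rw [hconj, hprod] at hm
    have hsq : Complex.normSq z₁ = 1 := by exact_mod_cast hm.symm
    have : ‖z₁‖ ^ 2 = 1 := by rw [← Complex.normSq_eq_norm_sq]; exact hsq
    nlinarith [norm_nonneg z₁]
  have hn2 : ‖z₂‖ = 1 := by rw [← hconj, Complex.norm_conj]; exact hn1
  have hfac : (α - z₁) * (α - z₂) = 0 := by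
    have e : (α - z₁) * (α - z₂) = α ^ 2 - (z₁ + z₂) * α + z₁ * z₂ := by ring
    rw [e, hsum, hprod, h]
  rcases mul_eq_zero.mp hfac with hα | hα
  · rw [sub_eq_zero.mp hα]; exact hn1
  · rw [sub_eq_zero.mp hα]; exact hn2

/-- For real `y > 2`, the roots of `x² - yx + 1` are `τ = (y + √(y²-4))/2` and `τ⁻¹`. -/
theorem eq_or_eq_inv_of_quad_root {y : ℝ} (hy : 2 < y) {α : ℂ} (h : α ^ 2 - (y : ℂ) * α + 1 = 0) :
    α = (((y + Real.sqrt (y ^ 2 - 4)) / 2 : ℝ) : ℂ) ∨ α = ((((y + Real.sqrt (y ^ 2 - 4)) / 2)⁻¹ : ℝ) : ℂ) := by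
  have hpos : 0 ≤ y ^ 2 - 4 := by nlinarith
  set t : ℝ := Real.sqrt (y ^ 2 - 4) with ht
  have ht2 : t ^ 2 = y ^ 2 - 4 := by rw [ht]; exact Real.sq_sqrt hpos
  set r₁ : ℝ := (y + t) / 2 with hr₁
  set r₂ : ℝ := (y - t) / 2 with hr₂
  have hsum : r₁ + r₂ = y := by rw [hr₁, hr₂]; ring
  have hprod : r₁ * r₂ = 1 := by rw [hr₁, hr₂]; nlinarith
  have hinv : r₁⁻¹ = r₂ := inv_eq_of_mul_eq_one_right hprod
  have hfac : (α - r₁) * (α - r₂) = 0 := by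
    have e : (α - r₁) * (α - r₂) = α ^ 2 - ((r₁ : ℂ) + r₂) * α + (r₁ : ℂ) * r₂ := by ring
    have h1 : (r₁ : ℂ) + r₂ = (y : ℂ) := by exact_mod_cast hsum
    have h2 : (r₁ : ℂ) * r₂ = 1 := by exact_mod_cast hprod
    rw [e, h1, h2, h]
  rw [hinv]
  rcases mul_eq_zero.mp hfac with hα | hα
  · exact Or.inl (sub_eq_zero.mp hα)
  · exact Or.inr (sub_eq_zero.mp hα)

/-- **`L = ∏ᵢ (x² - yᵢ x + 1)` over `ℂ`**, over the five real roots of the trace polynomial, with their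
rational brackets (the method of `LehmerExactMeasure`, re-run with the factorisation exported). -/
theorem lehmerPoly_map_eq_prod : ∃ y₁ y₂ y₃ y₄ y₅ : ℝ,
    (-2 < y₁ ∧ y₁ < 2) ∧ (-2 < y₂ ∧ y₂ < 2) ∧ (-2 < y₃ ∧ y₃ < 2) ∧ (-2 < y₄ ∧ y₄ < 2) ∧
    ((1176280818259 / 10 ^ 12 : ℝ) + (1176280818259 / 10 ^ 12)⁻¹ < y₅ ∧
      y₅ < (1176280818260 / 10 ^ 12 : ℝ) + (1176280818260 / 10 ^ 12)⁻¹) ∧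
    lehmerPoly.map (Int.castRingHom ℂ) =
      (({(y₁ : ℂ), (y₂ : ℂ), (y₃ : ℂ), (y₄ : ℂ), (y₅ : ℂ)} : Multiset ℂ).map
        fun w => (X ^ 2 - C w * X + 1 : ℂ[X])).prod := by
  obtain ⟨y₁, y₂, y₃, y₄, y₅, h1, h2, h3, h4, h5, hroots⟩ := lehmer_trace_roots
  have hc_lo : (2 : ℝ) < (1176280818259 / 10 ^ 12 : ℝ) + (1176280818259 / 10 ^ 12)⁻¹ := by norm_num
  have hy5 : 2 < y₅ := lt_trans hc_lo h5.1
  refine ⟨y₁, y₂, y₃, y₄, y₅, ⟨h1.1, by linarith [h1.2]⟩, ⟨by linarith [h2.1], by linarith [h2.2]⟩,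
    ⟨by linarith [h3.1], by linarith [h3.2]⟩, ⟨by linarith [h4.1], by linarith [h4.2]⟩, h5, ?_⟩
  have hrootsC : ∀ y ∈ [y₁, y₂, y₃, y₄, y₅],
      (y : ℂ) ^ 5 + (y : ℂ) ^ 4 - 5 * (y : ℂ) ^ 3 - 5 * (y : ℂ) ^ 2 + 4 * (y : ℂ) + 3 = 0 := by
    intro y hy
    exact_mod_cast hroots y hy
  set s : Multiset ℂ := {(y₁ : ℂ), (y₂ : ℂ), (y₃ : ℂ), (y₄ : ℂ), (y₅ : ℂ)} with hs
  have h12 : (y₁ : ℂ) ≠ y₂ := by exact_mod_cast ne_of_lt (by linarith [h1.2, h2.1] : y₁ < y₂)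
  have h13 : (y₁ : ℂ) ≠ y₃ := by exact_mod_cast ne_of_lt (by linarith [h1.2, h3.1] : y₁ < y₃)
  have h14 : (y₁ : ℂ) ≠ y₄ := by exact_mod_cast ne_of_lt (by linarith [h1.2, h4.1] : y₁ < y₄)
  have h15 : (y₁ : ℂ) ≠ y₅ := by exact_mod_cast ne_of_lt (by linarith [h1.2, hy5] : y₁ < y₅)
  have h23 : (y₂ : ℂ) ≠ y₃ := by exact_mod_cast ne_of_lt (by linarith [h2.2, h3.1] : y₂ < y₃)
  have h24 : (y₂ : ℂ) ≠ y₄ := by exact_mod_cast ne_of_lt (by linarith [h2.2, h4.1] : y₂ < y₄)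
  have h25 : (y₂ : ℂ) ≠ y₅ := by exact_mod_cast ne_of_lt (by linarith [h2.2, hy5] : y₂ < y₅)
  have h34 : (y₃ : ℂ) ≠ y₄ := by exact_mod_cast ne_of_lt (by linarith [h3.2, h4.1] : y₃ < y₄)
  have h35 : (y₃ : ℂ) ≠ y₅ := by exact_mod_cast ne_of_lt (by linarith [h3.2, hy5] : y₃ < y₅)
  have h45 : (y₄ : ℂ) ≠ y₅ := by exact_mod_cast ne_of_lt (by linarith [h4.2, hy5] : y₄ < y₅)
  have hs_card : Multiset.card s = 5 := by rw [hs]; simp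
  have hs_nodup : s.Nodup := by
    rw [hs]
    simp [Multiset.insert_eq_cons, h12, h13, h14, h15, h23, h24, h25, h34, h35, h45]
  have hQeval : ∀ t : ℂ, (X ^ 5 + X ^ 4 - 5 * X ^ 3 - 5 * X ^ 2 + 4 * X + 3 : ℂ[X]).eval t =
      t ^ 5 + t ^ 4 - 5 * t ^ 3 - 5 * t ^ 2 + 4 * t + 3 := by
    intro t; simp
  have hQmonic : (X ^ 5 + X ^ 4 - 5 * X ^ 3 - 5 * X ^ 2 + 4 * X + 3 : ℂ[X]).Monic := by monicity!
  have hQdeg : (X ^ 5 + X ^ 4 - 5 * X ^ 3 - 5 * X ^ 2 + 4 * X + 3 : ℂ[X]).natDegree = 5 := by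
    compute_degree!
  have hQne : (X ^ 5 + X ^ 4 - 5 * X ^ 3 - 5 * X ^ 2 + 4 * X + 3 : ℂ[X]) ≠ 0 := hQmonic.ne_zero
  have hs_sub : s ⊆ (X ^ 5 + X ^ 4 - 5 * X ^ 3 - 5 * X ^ 2 + 4 * X + 3 : ℂ[X]).roots := by
    intro w hw
    rw [mem_roots hQne, IsRoot.def, hQeval]
    rw [hs] at hw
    simp only [Multiset.insert_eq_cons, Multiset.mem_cons, Multiset.mem_singleton] at hw
    rcases hw with rfl | rfl | rfl | rfl | rfl
    · exact hrootsC y₁ (by simp)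
    · exact hrootsC y₂ (by simp)
    · exact hrootsC y₃ (by simp)
    · exact hrootsC y₄ (by simp)
    · exact hrootsC y₅ (by simp)
  have hs_le : s ≤ (X ^ 5 + X ^ 4 - 5 * X ^ 3 - 5 * X ^ 2 + 4 * X + 3 : ℂ[X]).roots :=
    (Multiset.le_iff_subset hs_nodup).mpr hs_sub
  have hroots_eq : (X ^ 5 + X ^ 4 - 5 * X ^ 3 - 5 * X ^ 2 + 4 * X + 3 : ℂ[X]).roots = s := by
    symm
    apply Multiset.eq_of_le_of_card_le hs_le
    rw [hs_card]
    exact (card_roots' _).trans_eq hQdeg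
  have hQsplit : (X ^ 5 + X ^ 4 - 5 * X ^ 3 - 5 * X ^ 2 + 4 * X + 3 : ℂ[X]) =
      (s.map fun w => X - C w).prod := by
    rw [← hroots_eq]
    exact (IsAlgClosed.splits _).eq_prod_roots_of_monic hQmonic
  have hQprod : ∀ t : ℂ, t ^ 5 + t ^ 4 - 5 * t ^ 3 - 5 * t ^ 2 + 4 * t + 3 =
      (t - y₁) * (t - y₂) * (t - y₃) * (t - y₄) * (t - y₅) := by
    intro t
    have h' := congrArg (Polynomial.eval t) hQsplit
    rw [hQeval, eval_multiset_prod, hs] at h'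
    simp only [Multiset.insert_eq_cons, Multiset.map_cons, Multiset.map_singleton, Multiset.prod_cons,
      Multiset.prod_singleton, eval_sub, eval_X, eval_C] at h'
    linear_combination h'
  have hLeval : ∀ x : ℂ, (lehmerPoly.map (Int.castRingHom ℂ)).eval x =
      x ^ 10 + x ^ 9 - x ^ 7 - x ^ 6 - x ^ 5 - x ^ 4 - x ^ 3 + x + 1 := by
    intro x
    rw [eval_map, ← algebraMap_int_eq, ← aeval_def, aeval_lehmerPoly]
  apply Polynomial.funext
  intro x
  rw [hLeval, eval_multiset_prod, hs]
  simp only [Multiset.insert_eq_cons, Multiset.map_cons, Multiset.map_singleton, Multiset.prod_cons,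
    Multiset.prod_singleton, eval_add, eval_sub, eval_mul, eval_pow, eval_X, eval_C, eval_one]
  rcases eq_or_ne x 0 with rfl | hx
  · norm_num
  · rw [lehmer_eval_eq_trace x hx, hQprod (x + x⁻¹)]
    field_simp
    ring

/-- **Lehmer's number is a Salem number.**  There is a real `τ > 1` with `M(L) = τ`, such that `τ` and
`τ⁻¹` are roots of Lehmer's polynomial `L` and every complex root of `L` is `τ`, `τ⁻¹` or of modulus `1`.
(With `irreducible_lehmerPoly` and `deg L = 10`: `τ = 1.17628…` is a Salem number of degree `10` whose
minimal polynomial is `L`.) -/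
theorem lehmer_salem : ∃ τ : ℝ, 1 < τ ∧ intMahlerMeasure lehmerPoly = τ ∧
    (τ : ℂ) ∈ (lehmerPoly.map (Int.castRingHom ℂ)).roots ∧
    ((τ⁻¹ : ℝ) : ℂ) ∈ (lehmerPoly.map (Int.castRingHom ℂ)).roots ∧
    ∀ α ∈ (lehmerPoly.map (Int.castRingHom ℂ)).roots, α = τ ∨ α = ((τ⁻¹ : ℝ) : ℂ) ∨ ‖α‖ = 1 := by
  obtain ⟨y₁, y₂, y₃, y₄, y₅, h1, h2, h3, h4, h5, hLP⟩ := lehmerPoly_map_eq_prod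
  have hc_lo : (2 : ℝ) < (1176280818259 / 10 ^ 12 : ℝ) + (1176280818259 / 10 ^ 12)⁻¹ := by norm_num
  have hy5 : 2 < y₅ := lt_trans hc_lo h5.1
  set τ : ℝ := (y₅ + Real.sqrt (y₅ ^ 2 - 4)) / 2 with hτ
  have ht0 : 0 ≤ Real.sqrt (y₅ ^ 2 - 4) := Real.sqrt_nonneg _
  have hτ1 : 1 < τ := by rw [hτ]; linarith
  have hL0 : lehmerPoly.map (Int.castRingHom ℂ) ≠ 0 := (lehmerPoly_monic.map _).ne_zero
  -- the quadratic factor `x² - y₅ x + 1` has the roots `τ`, `τ⁻¹`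
  have hpos : 0 ≤ y₅ ^ 2 - 4 := by nlinarith
  have ht2 : Real.sqrt (y₅ ^ 2 - 4) ^ 2 = y₅ ^ 2 - 4 := Real.sq_sqrt hpos
  have hτroot : (τ : ℂ) ^ 2 - (y₅ : ℂ) * τ + 1 = 0 := by
    have : τ ^ 2 - y₅ * τ + 1 = 0 := by rw [hτ]; nlinarith
    exact_mod_cast this
  have hτprod : τ * ((y₅ - Real.sqrt (y₅ ^ 2 - 4)) / 2) = 1 := by rw [hτ]; nlinarith
  have hτinv : τ⁻¹ = (y₅ - Real.sqrt (y₅ ^ 2 - 4)) / 2 := inv_eq_of_mul_eq_one_right hτprod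
  have hτinvroot : ((τ⁻¹ : ℝ) : ℂ) ^ 2 - (y₅ : ℂ) * ((τ⁻¹ : ℝ) : ℂ) + 1 = 0 := by
    have : (τ⁻¹) ^ 2 - y₅ * τ⁻¹ + 1 = 0 := by rw [hτinv]; nlinarith
    exact_mod_cast this
  -- evaluation of `L` as the product of the five quadratics
  have hLev : ∀ α : ℂ, (lehmerPoly.map (Int.castRingHom ℂ)).eval α =
      (α ^ 2 - y₁ * α + 1) * ((α ^ 2 - y₂ * α + 1) * ((α ^ 2 - y₃ * α + 1) *
        ((α ^ 2 - y₄ * α + 1) * (α ^ 2 - y₅ * α + 1)))) := by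
    intro α
    rw [hLP, eval_multiset_prod]
    simp only [Multiset.insert_eq_cons, Multiset.map_cons, Multiset.map_singleton, Multiset.prod_cons,
      Multiset.prod_singleton, eval_add, eval_sub, eval_mul, eval_pow, eval_X, eval_C, eval_one]
  have hmem : ∀ α : ℂ, α ^ 2 - (y₅ : ℂ) * α + 1 = 0 → α ∈ (lehmerPoly.map (Int.castRingHom ℂ)).roots := by
    intro α hα
    rw [mem_roots hL0, IsRoot.def, hLev, hα]
    ring
  refine ⟨τ, hτ1, ?_, hmem _ hτroot, hmem _ hτinvroot, ?_⟩
  · -- `M(L) = τ`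
    unfold intMahlerMeasure
    rw [hLP, prod_mahlerMeasure_eq_mahlerMeasure_prod, Multiset.map_map]
    simp only [Multiset.insert_eq_cons, Multiset.map_cons, Multiset.map_singleton, Multiset.prod_cons,
      Multiset.prod_singleton, Function.comp_apply]
    rw [mahlerMeasure_quad_of_abs_lt_two h1.1 h1.2, mahlerMeasure_quad_of_abs_lt_two h2.1 h2.2,
      mahlerMeasure_quad_of_abs_lt_two h3.1 h3.2, mahlerMeasure_quad_of_abs_lt_two h4.1 h4.2,
      mahlerMeasure_quad_of_two_lt hy5, hτ]
    ring
  · intro α hα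
    rw [mem_roots hL0, IsRoot.def, hLev] at hα
    rcases mul_eq_zero.mp hα with h | hα
    · exact Or.inr (Or.inr (norm_eq_one_of_quad_root h1.1 h1.2 h))
    rcases mul_eq_zero.mp hα with h | hα
    · exact Or.inr (Or.inr (norm_eq_one_of_quad_root h2.1 h2.2 h))
    rcases mul_eq_zero.mp hα with h | hα
    · exact Or.inr (Or.inr (norm_eq_one_of_quad_root h3.1 h3.2 h))
    rcases mul_eq_zero.mp hα with h | h
    · exact Or.inr (Or.inr (norm_eq_one_of_quad_root h4.1 h4.2 h))
    · rcases eq_or_eq_inv_of_quad_root hy5 h with h' | h'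
      · exact Or.inl (by rw [h', hτ])
      · exact Or.inr (Or.inl (by rw [h', hτ]))

end Summit.Ventures.DiscreteObjects.Mahler
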